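import Summits.CriticalPhenomena.PercolationContinuityZ3.Theorems.Transplant.SkelFrmBParamsFoot
import Summits.CriticalPhenomena.PercolationContinuityZ3.Theorems.Transplant.SkelFrmBParamsSlotsT
import Summits.CriticalPhenomena.PercolationContinuityZ3.Theorems.Transplant.SkelNegBParamsFaceTop
import HarnessLib

/-!
# N2 (frames-only node `SamePDropOfSkeletonFrm₁`, OPEN) params column over `PlanarSkeletonFrm` — (ζ″) ledger, shape (B′) of record ((R-14)):
# MECHANICAL PORT of N1's `SkelNegBParamsFaceTop` — chain of record `NegB`, part FaceTop: THE (F) NUMBERS LAYER'S LATTICE / TOP-LAYER / FOOT BINDERS AT THE LEDGER — hp-8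
# g33's `numsX_of_floors` / `numsY_of_floors` / `hkits_faceSteps_of_nums5` hypotheses `hA hκ₀ hc0 hc1 hmod0 hD hDd hv hlay hmodlo hmodhi hnear₂` served verbatim at `prF`
# (stmt-g15 … (N1 title abridged; see `SkelNegBParamsFaceTop`)
builds on p205010 (kernel theorem, internal audit signed; external expert review pending) — nothing in this file uses p205010; NOTHING is claimed about the
open node `SamePDropOfSkeletonFrm₁` (`SamePDropOfSkeletonNeg₁` is CLOSED in the tree and untouched by this file).
Status sentence (coordinator 2026-08-20T04:30Z): "θ(p_c) = 0 on ℤ^d, all d ≥ 2 — kernel-verified (Lean 4/Mathlib, standard axioms); internal adversarial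
audit SIGNED 2026-08-20 04:29Z; external expert review pending."
Lane `prim-bschramm-*`, seat `prim-bschramm-p1` (gen 17; (F) value layer, lead g11 06:35:07Z) running stmt-g19's port tool of record; helper file (`--supports stmt-CriticalPhenomena-4575 --as helper`); ledger HOME/prim-bschramm-stmt/FRM-PARAMS.md §9, (R-14).
PORT RULES (HOME/prim-bschramm-stmt-g19/lean/port_frm.py, the tool of record per (R-14)): outer namespace `PlanarSkeletonNeg ↦ PlanarSkeletonFrm`, carrier binder
`(Φ : PlanarSkeletonFrm G)`, record binder `(D : Skelφ.StepI.DataNS V)` (the selectors travel IN the record, `SkelPhiStepIDataNS`); section variables INLINED into every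
declaration header; inner namespaces (`Neg`/`NegB`/`KS`/…) and every short name KEPT so all cross-references resolve unchanged; declarations using no section variable are
NOT re-declared (N1's originals are referenced fully qualified). Mathematical content, proofs, docstrings and citations are N1's, verbatim, except where stated next.
NOT PORTED: the non-A lattice facts `c₀_eq_A_mul_u₀/c₁_eq_A_mul_u₁/u_nonneg/D_eq_A_sq_mul/lattice_R` (they read N1's RETIRED units `KS.u₀/u₁`;
the N2 chain is the A-chain — see `SkelFrmBParamsFaceTopA`/`FaceUnits`); KEPT: `modulus_top`, `hlay_T`, `hnear₂_R`. SELECTORS IN THIS FILE ((R-14) condition of record — joint selection, `D.sN`'s first argument is the literal handed to `D.sM`): none (pure port; the pairs are read through their N1 names).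
N1 HEADER (kept for the reader):
helper file (`--supports stmt-CriticalPhenomena-4575 --as helper`); ledger HOME/prim-bschramm-stmt/NEG-PARAMS.md.
* §1 `c₀_eq_A_mul_u₀`, `c₁_eq_A_mul_u₁`, `u_nonneg`, `D_eq_A_sq_mul`, `modulus_top`, **`lattice_R`** (the bundle); §2 **`hlay_T`**; §3 **`hnear₂_R`**.
[cite: KozmaNitzan2024, §4 Lemma 10 (pp. 17–21), Lemma 12 (pp. 23–25)] [cite: MartineauTassion2017, §4.1, §4.3 Lemma 4.2]
-/

noncomputable section

open scoped Classical

namespace Summit.CriticalPhenomena.PercolationContinuityZ3.Theorems.Transplant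

namespace PlanarSkeletonFrm

namespace NegB

open Literature.Probability.Percolation Literature.Probability.LatticeModels SimpleGraph
open SkelConc (Consts)
open Skelφ (shearUnit)
open Skelφ.StepI (DataN)
open TwoAxis.Para (modulus)
open Neg

/-! ## §1 The lattice record's unit / determinant / top-layer facts -/

section Lattice





/-- **The top-layer sandwich** `n_Lℓ_L − U_L + 1 ≤ m ≤ n_Lℓ_L` (`1 ≤ n_L`; hp-8's `hmodlo`/`hmodhi`). [folklore] -/
theorem modulus_top (κ : Consts) {V : Type} [DecidableEq V] [Countable V] {G : SimpleGraph V} [G.LocallyFinite] (Φ : PlanarSkeletonFrm G) (t : V) (p : unitInterval) (D : Skelφ.StepI.DataNS V) (g : ℕ) (f : ℕ) (hn : 1 ≤ nL κ Φ t p D g f) :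
    (nL κ Φ t p D g f : ℤ) * ℓL κ Φ t p D g f - (shearUnit (nL κ Φ t p D g f) (hL κ Φ t p D g f) : ℤ) + 1 ≤
        modulus (nL κ Φ t p D g f) (hL κ Φ t p D g f) (vL κ Φ t p D g f) (vβL κ Φ t p D g f) ∧
      modulus (nL κ Φ t p D g f) (hL κ Φ t p D g f) (vL κ Φ t p D g f) (vβL κ Φ t p D g f) ≤ (nL κ Φ t p D g f : ℤ) * ℓL κ Φ t p D g f := by
  obtain ⟨h1, h2⟩ := Skelφ.NegPrm.modulus_vβOf hn (hL κ Φ t p D g f) (ℓL κ Φ t p D g f) (vL κ Φ t p D g f)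
  have hU : (nL κ Φ t p D g f : ℤ) ≤ (shearUnit (nL κ Φ t p D g f) (hL κ Φ t p D g f) : ℤ) := by
    simp only [Skelφ.shearUnit, Nat.cast_add, Int.natCast_natAbs]; linarith [abs_nonneg (hL κ Φ t p D g f)]
  exact ⟨by change _ ≤ modulus _ _ _ (Skelφ.NegPrm.vβOf _ _ _ _); linarith, h2⟩


end Lattice

/-! ## §2 The layer inequality at `g := gT` -/

namespace KS

section Layer

/-- **`hlay`** (hp-8's shape `(n_L + |h_L| : ℕ) ≤ n_L·ℓ_L + 1`) at `g := gT mk gx`, any `f` — one factor of `layer_T`'s `(RA′+3)·U_L ≤ n_Lℓ_L + 1`. [folklore] -/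
theorem hlay_T (κ : Consts) {V : Type} [DecidableEq V] [Countable V] {G : SimpleGraph V} [G.LocallyFinite] (Φ : PlanarSkeletonFrm G) (t : V) (p : unitInterval) (D : Skelφ.StepI.DataNS V) (mk : ℕ) (gx : Neg.FSlot) (f : ℕ) (hN : EqNumL κ Φ t p D (gT mk gx κ Φ t p D) f) (hκ : (hL κ Φ t p D (gT mk gx κ Φ t p D) f).natAbs ≤ 10 * nL κ Φ t p D (gT mk gx κ Φ t p D) f) :
    ((nL κ Φ t p D (gT mk gx κ Φ t p D) f + (hL κ Φ t p D (gT mk gx κ Φ t p D) f).natAbs : ℕ) : ℤ) ≤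
      (nL κ Φ t p D (gT mk gx κ Φ t p D) f : ℤ) * ℓL κ Φ t p D (gT mk gx κ Φ t p D) f + 1 := by
  have h := layer_T κ Φ t p D mk gx f hN hκ
  have hU : (0 : ℤ) ≤ ((nL κ Φ t p D (gT mk gx κ Φ t p D) f + (hL κ Φ t p D (gT mk gx κ Φ t p D) f).natAbs : ℕ) : ℤ) := by positivity
  have hR : (1 : ℤ) ≤ (RA' κ Φ t p D mk : ℤ) + 3 := by omega
  nlinarith

end Layer

end KS

/-! ## §3 The foot reading for any base vertex -/

section Foot

/-- **`hnear₂`** (hp-8's binder shape, ANY base vertex `c`, ANY map `φ′`) at `kA := (kFoot₀ sα sβ, kFoot₁ sα sβ)`: a vertex within planar extents `(sα, sβ)`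
of `c` has fine position within `(kFoot₀, kFoot₁)` in the fine skeleton about `c`. [folklore] -/
theorem hnear₂_R (κ : Consts) {V : Type} [DecidableEq V] [Countable V] {G : SimpleGraph V} [G.LocallyFinite] (Φ : PlanarSkeletonFrm G) (t : V) (p : unitInterval) (D : Skelφ.StepI.DataNS V) (g : ℕ) (f : ℕ) (hN : EqNumL κ Φ t p D g f) (sα sβ : ℤ) (φ' : V → Site 2) (c w : V) (h0 : |φ' w 0 - φ' c 0| ≤ sα) (h1 : |φ' w 1 - φ' c 1| ≤ sβ) :
    |Skelφ.fineSkel φ' c (prF κ Φ t p D g f).A ((prF κ Φ t p D g f).n : ℤ) (prF κ Φ t p D g f).h (prF κ Φ t p D g f).vα (prF κ Φ t p D g f).vβ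
        (prF κ Φ t p D g f).c₀ (prF κ Φ t p D g f).c₁ ((prF κ Φ t p D g f).D / 2) ((prF κ Φ t p D g f).D / 2) (prF κ Φ t p D g f).D w 0| ≤
        kFoot₀ κ Φ t p D g f sα sβ ∧
      |Skelφ.fineSkel φ' c (prF κ Φ t p D g f).A ((prF κ Φ t p D g f).n : ℤ) (prF κ Φ t p D g f).h (prF κ Φ t p D g f).vα (prF κ Φ t p D g f).vβ
        (prF κ Φ t p D g f).c₀ (prF κ Φ t p D g f).c₁ ((prF κ Φ t p D g f).D / 2) ((prF κ Φ t p D g f).D / 2) (prF κ Φ t p D g f).D w 1| ≤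
        kFoot₁ κ Φ t p D g f sα sβ := by
  obtain ⟨-, -, -, hc₀, hc₁, hD⟩ := prF_pos κ Φ t p D g f hN
  exact Skelφ.abs_fineSkel_le_of_near₂ (φ := φ') c hD hc₀.le hc₁.le (hL0_R κ Φ t p D g f sα sβ hN) (hL1_R κ Φ t p D g f sα sβ hN) h0 h1

end Foot

end NegB

end PlanarSkeletonFrm

end Summit.CriticalPhenomena.PercolationContinuityZ3.Theorems.Transplant

end
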